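import Literature.Analysis.InnerProduct.CourantFischerBounds
import HarnessLib

/-!
# The Weinberger–Bazley–Fox method of truncation (finite-dimensional form statement)

Source: A. Weinstein, W. Stenger, *Methods of Intermediate Problems for Eigenvalues — Theory and Ramifications*, Academic Press
1972, Chapter 4 §10 «Weinberger–Bazley–Fox Method of Truncation», pp. 63–67 [cite: WeinsteinStenger1972, Ch. 4 §10].
For a self-adjoint base operator `A` with lowest eigenpairs `(λ₁, u₁), …, (λ_N, u_N)` (increasing enumeration) the *truncation
operator of order `N`* is `T_N = A U_N + λ_{N+1}(I − U_N) = U_N (A − λ_{N+1} I) U_N + λ_{N+1} I` (their (1), (2), (4)), `U_N` the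
orthogonal projection onto `sp{u₁, …, u_N}`; the printed inequalities (3) are
`(T₁u, u) ≤ (T₂u, u) ≤ ⋯ ≤ (T_N u, u) ≤ ⋯ ≤ (Au, u)` for all `u` — the truncation is DOMINATED by the base operator, and refining
the truncation is monotone.  (Weinberger 1959 for problems of the first type, Bazley–Fox 1961 for the second type.)

This file types the statement for a symmetric operator `T` on a FINITE-DIMENSIONAL inner-product space, written with Mathlib's
DECREASING enumeration `λ↓₀ ≥ λ↓₁ ≥ ⋯` (`LinearMap.IsSymmetric.eigenvalues`, `eigenvectorBasis`), i.e. for the book's `A = −T`: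
keeping the top `N` eigen-directions exactly and replacing every lower eigenvalue by `λ↓_N` gives a quadratic form that dominates
`re ⟪T u, u⟫` FROM ABOVE, and the domination tightens as `N` grows.  Everything is stated definition-free, as explicit sums over the
eigenvector basis `xᵢ` with weights `‖⟪xᵢ, u⟫‖²`:

* (the spectral resolution `re ⟪T u, u⟫ = Σᵢ λ↓ᵢ ‖⟪xᵢ, u⟫‖²`, their starting point, is the tree's
  `Literature.Analysis.InnerProduct.re_inner_apply_self_eq_sum`);
* ★ `re_inner_apply_self_le_truncation` — `re ⟪T u, u⟫ ≤ Σ_{i<N} λ↓ᵢ ‖⟪xᵢ,u⟫‖² + λ↓_N Σ_{i≥N} ‖⟪xᵢ,u⟫‖²` (their (3), last inequality);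
* ★ `truncation_antitone` — for `N ≤ N'` the order-`N'` form is `≤` the order-`N` form (their (3), the chain).

TODO(general form): the book states this for self-adjoint operators bounded below with `N` isolated eigenvalues below the rest of
the spectrum (spectral-measure remainder `λ_{N+1} ∫ dE_λ`); only the finite-dimensional case is typed here.  This is the classical
source of the «kept set + dominating multiple of the identity» tail bounds used by certified Galerkin computations (e.g. the
K-weight tail theorem of the `pub-ymgap` flow-data lineages); nothing here is specific to them.
-/

noncomputable section

open scoped InnerProductSpace
open Finset Module

namespace Literature.Analysis.OperatorTheory

variable {𝕜 : Type*} [RCLike 𝕜] {E : Type*} [NormedAddCommGroup E] [InnerProductSpace 𝕜 E] [FiniteDimensional 𝕜 E]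
  {n : ℕ} {T : E →ₗ[𝕜] E}

/-- ★ **Weinberger–Bazley–Fox truncation is dominated by the base operator** (Weinstein–Stenger Ch. 4 §10, inequalities (3),
last inequality `(T_N u, u) ≤ (A u, u)`, written for Mathlib's decreasing enumeration, i.e. for `A = −T`): keeping the eigenvalues
`λ↓ᵢ`, `i < N`, and replacing every `λ↓ᵢ`, `i ≥ N`, by `λ↓_N` can only increase the form:
`re ⟪T u, u⟫ ≤ Σᵢ (if i < N then λ↓ᵢ else λ↓_N) ‖⟪xᵢ, u⟫‖²`. [cite: WeinsteinStenger1972, Ch. 4 §10 eq. (3)] -/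
theorem re_inner_apply_self_le_truncation (hT : T.IsSymmetric) (hn : finrank 𝕜 E = n) (N : Fin n) (u : E) :
    RCLike.re ⟪T u, u⟫_𝕜 ≤
      ∑ i, (if i < N then hT.eigenvalues hn i else hT.eigenvalues hn N) * ‖⟪hT.eigenvectorBasis hn i, u⟫_𝕜‖ ^ 2 := by
  rw [Literature.Analysis.InnerProduct.re_inner_apply_self_eq_sum hT hn u]
  refine sum_le_sum fun i _ => mul_le_mul_of_nonneg_right ?_ (sq_nonneg _)
  split_ifs with h
  · exact le_rfl
  · exact hT.eigenvalues_antitone hn (not_lt.1 h)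

/-- ★ **Refining the truncation is monotone** (Weinstein–Stenger Ch. 4 §10, the chain in (3): `(T_M u, u) ≤ (T_N u, u)` for
`M ≤ N`, written for the decreasing enumeration): for `N ≤ N'` the order-`N'` truncation form is at most the order-`N` one.
[cite: WeinsteinStenger1972, Ch. 4 §10 eq. (3)] -/
theorem truncation_antitone (hT : T.IsSymmetric) (hn : finrank 𝕜 E = n) {N N' : Fin n} (hNN' : N ≤ N') (u : E) :
    ∑ i, (if i < N' then hT.eigenvalues hn i else hT.eigenvalues hn N') * ‖⟪hT.eigenvectorBasis hn i, u⟫_𝕜‖ ^ 2 ≤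
      ∑ i, (if i < N then hT.eigenvalues hn i else hT.eigenvalues hn N) * ‖⟪hT.eigenvectorBasis hn i, u⟫_𝕜‖ ^ 2 := by
  refine sum_le_sum fun i _ => mul_le_mul_of_nonneg_right ?_ (sq_nonneg _)
  have hanti := hT.eigenvalues_antitone hn
  by_cases h1 : i < N
  · have h2 : i < N' := lt_of_lt_of_le h1 hNN'
    simp only [h1, h2, if_true, le_refl]
  · by_cases h2 : i < N'
    · simp only [h1, h2, if_true, if_false]
      exact hanti (not_lt.1 h1)
    · simp only [h1, h2, if_false]
      exact hanti hNN'

/-- The truncation form with `N = 0`... is not available (`Fin n` may be empty); instead the coarsest useful consequence: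
every form value is at most `λ↓₀ ‖u‖²`-like — precisely `re ⟪T u, u⟫ ≤ λ↓_N · Σᵢ ‖⟪xᵢ, u⟫‖²` whenever all kept eigenvalues are
replaced too (`N` minimal in `Fin n`, i.e. `N = ⟨0, _⟩`). [cite: WeinsteinStenger1972, Ch. 4 §10 eq. (3)] -/
theorem re_inner_apply_self_le_top_mul_sum (hT : T.IsSymmetric) (hn : finrank 𝕜 E = n) (hpos : 0 < n) (u : E) :
    RCLike.re ⟪T u, u⟫_𝕜 ≤ hT.eigenvalues hn ⟨0, hpos⟩ * ∑ i, ‖⟪hT.eigenvectorBasis hn i, u⟫_𝕜‖ ^ 2 := by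
  have h := re_inner_apply_self_le_truncation hT hn ⟨0, hpos⟩ u
  rw [mul_sum]
  refine h.trans (le_of_eq (sum_congr rfl fun i _ => ?_))
  have : ¬ (i < (⟨0, hpos⟩ : Fin n)) := fun hi => Nat.not_lt_zero _ (Fin.lt_def.1 hi)
  simp only [this, if_false]

end Literature.Analysis.OperatorTheory
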